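import Literature.Analysis.OperatorTheory.NuclearDiagonalBound
import Literature.Analysis.OperatorTheory.HilbertSchmidtOrthogonalSum
import HarnessLib

/-!
# A bounded operator that is nuclear along ONE Hilbert basis (`Σ_k ‖T e_k‖ < ∞`) is trace class: Hilbert–Schmidt along every
# Hilbert basis, absolutely summable diagonal along every Hilbert basis, with a basis-free sum (Reed–Simon I, Thm. VI.18, VI.24)

Topic `Literature/Analysis/OperatorTheory`; theorems only (no definition, no named fact, no instance); continuation of
★ `NuclearDiagonalBound` (the diagonal of `Σ_k λ_k |p_k⟩⟨q_k|`) and ★ `HilbertSchmidtOrthogonalSum` (basis-independence of `Σ_i ‖T e_i‖²`).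
Mathlib has no trace class; the three CONSEQUENCES of «`T` is trace class» that the automorphic consumers use (cell `hodgecm-mathlib`,
letter ★ `Literature.NumberTheory.Automorphic.UnitaryGroup.ArchIntegratedOperatorTraceClass` = [Knapp1986, Thm. 10.2] for `π(f)`) are:
(i) `Σ_j ‖T b_j‖² < ∞` for every Hilbert basis `b`; (ii) the diagonal `j ↦ ⟨b_j, T b_j⟩` is summable for every Hilbert basis `b`;
(iii) its sum does not depend on `b`.  This file proves all three from the hypothesis that `T` is NUCLEAR ALONG ONE HILBERT BASIS
`e`, i.e. `Σ_k ‖T e_k‖ < ∞` — the form in which Knapp's proof of Thm. 10.2 delivers `π(f)` (along a basis adapted to the `K`-types: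
`Σ_τ dim E(τ) · ‖π(f)|_{E(τ)}‖ < ∞`).  The expansion `T = Σ_k |T e_k⟩⟨e_k|` is the nuclear representation; after the rescaling
`p_k = s_k⁻¹ T e_k`, `q_k = s_k e_k`, `s_k = ‖T e_k‖^{1/2}` it satisfies the hypothesis `Σ_k (‖p_k‖² + ‖q_k‖²) = 2 Σ_k ‖T e_k‖ < ∞` of
★ `tsum_norm_rankOne_diag_le`.

* `HilbertBasis.hasSum_inner_smul_apply` — `T φ = Σ_k ⟨e_k, φ⟩ T e_k`;
* `hasSum_inner_mul_inner_apply_diag` — `⟨x, T x⟩ = Σ_k ⟨e_k, x⟩ ⟨x, T e_k⟩`;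
* `summable_norm_inner_apply_self_of_summable_norm_apply`, `tsum_norm_inner_apply_self_le` — (ii) with the bound
  `Σ_j |⟨b_j, T b_j⟩| ≤ 2 Σ_k ‖T e_k‖`;
* `tsum_inner_apply_self_eq_of_summable_norm_apply` — `Σ_j ⟨b_j, T b_j⟩ = Σ_k ⟨e_k, T e_k⟩`, hence (iii)
  `tsum_inner_apply_self_eq_of_hilbertBasis_of_summable_norm_apply`;
* `summable_norm_sq_apply_of_summable_norm_apply`, `tsum_coe_nnnorm_sq_apply_lt_top_of_summable_norm_apply` — (i);
* `traceClass_clauses_of_summable_norm_apply` — (i) ∧ (ii) ∧ (iii) packaged in the shape of the automorphic letter.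

## References
* M. Reed, B. Simon, *Methods of Modern Mathematical Physics I: Functional Analysis* (1972), §VI.6, Thm. VI.18, Thm. VI.24 (PDF pp. 196–199
  of the held copy) [ReedSimon1972].
* A. W. Knapp, *Representation Theory of Semisimple Groups: An Overview Based on Examples* (1986), Thm. 10.2 (the consumer) [Knapp1986].
-/

noncomputable section

open Filter
open scoped Topology InnerProductSpace ENNReal NNReal ComplexConjugate

namespace Literature.Analysis.OperatorTheory

variable {E : Type*} [NormedAddCommGroup E] [InnerProductSpace ℂ E] [CompleteSpace E]
variable {ι ι' : Type*}

/-! ## The nuclear expansion along a Hilbert basis -/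

omit [CompleteSpace E] in
/-- **`T φ = Σ_k ⟨e_k, φ⟩ T e_k`** (norm-convergent): the image under the bounded `T` of the Fourier expansion of `φ` along the
Hilbert basis `e` (Mathlib `HilbertBasis.hasSum_repr`). [cite: ReedSimon1972, Thm. II.6] -/
theorem HilbertBasis.hasSum_inner_smul_apply (e : HilbertBasis ι ℂ E) (T : E →L[ℂ] E) (φ : E) :
    HasSum (fun k => ⟪e k, φ⟫_ℂ • T (e k)) (T φ) := by
  have h := (e.hasSum_repr φ).mapL T
  refine h.congr_fun fun k => ?_
  rw [ContinuousLinearMap.map_smul, HilbertBasis.repr_apply_apply]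

omit [CompleteSpace E] in
/-- **The diagonal coefficient through the expansion**: `⟨x, T x⟩ = Σ_k ⟨e_k, x⟩ ⟨x, T e_k⟩`. [cite: ReedSimon1972, Thm. VI.18 (proof)] -/
theorem hasSum_inner_mul_inner_apply_diag (e : HilbertBasis ι ℂ E) (T : E →L[ℂ] E) (x : E) :
    HasSum (fun k => ⟪e k, x⟫_ℂ * ⟪x, T (e k)⟫_ℂ) ⟪x, T x⟫_ℂ := by
  have h := (HilbertBasis.hasSum_inner_smul_apply e T x).mapL (innerSL ℂ x)
  refine h.congr_fun fun k => ?_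
  simp only [innerSL_apply_apply, inner_smul_right]

/-! ## The rescaled rank-one data `p_k = s_k⁻¹ T e_k`, `q_k = s_k e_k`, `s_k = √‖T e_k‖` -/

section Rescale

variable (e : HilbertBasis ι ℂ E) (T : E →L[ℂ] E)

omit [CompleteSpace E] in
/-- `‖s_k⁻¹ • T e_k‖ = s_k` for `s_k = √‖T e_k‖` (also when `T e_k = 0`, both sides being `0`). [folklore] -/
private theorem norm_sqrt_inv_smul_apply (k : ι) :
    ‖((Real.sqrt ‖T (e k)‖ : ℂ)⁻¹) • T (e k)‖ = Real.sqrt ‖T (e k)‖ := by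
  by_cases h0 : ‖T (e k)‖ = 0
  · rw [h0, Real.sqrt_zero]
    rw [norm_eq_zero] at h0
    rw [h0, smul_zero, norm_zero]
  · have hs : Real.sqrt ‖T (e k)‖ ≠ 0 := Real.sqrt_ne_zero'.2 (lt_of_le_of_ne (norm_nonneg _) (Ne.symm h0))
    rw [norm_smul, norm_inv, Complex.norm_real, Real.norm_of_nonneg (Real.sqrt_nonneg _)]
    have hsq : Real.sqrt ‖T (e k)‖ * Real.sqrt ‖T (e k)‖ = ‖T (e k)‖ := Real.mul_self_sqrt (norm_nonneg _)
    field_simp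
    linarith [hsq]

omit [CompleteSpace E] in
/-- `‖s_k • e_k‖ = s_k`. [folklore] -/
private theorem norm_sqrt_smul_basis (k : ι) :
    ‖(Real.sqrt ‖T (e k)‖ : ℂ) • (e k)‖ = Real.sqrt ‖T (e k)‖ := by
  rw [norm_smul, Complex.norm_real, Real.norm_of_nonneg (Real.sqrt_nonneg _), e.orthonormal.1 k, mul_one]

omit [CompleteSpace E] in
/-- The rescaled rank-one term equals the expansion term: `⟨x, p_k⟩ ⟨q_k, x⟩ = ⟨e_k, x⟩ ⟨x, T e_k⟩`. [folklore] -/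
private theorem inner_rescale_mul_inner_rescale (k : ι) (x : E) :
    ⟪x, ((Real.sqrt ‖T (e k)‖ : ℂ)⁻¹) • T (e k)⟫_ℂ * ⟪(Real.sqrt ‖T (e k)‖ : ℂ) • (e k), x⟫_ℂ =
      ⟪e k, x⟫_ℂ * ⟪x, T (e k)⟫_ℂ := by
  rw [inner_smul_right, inner_smul_left, Complex.conj_ofReal]
  by_cases h0 : ‖T (e k)‖ = 0
  · have hT0 : T (e k) = 0 := norm_eq_zero.1 h0
    simp [hT0]
  · have hs : (Real.sqrt ‖T (e k)‖ : ℂ) ≠ 0 := by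
      rw [Ne, Complex.ofReal_eq_zero]
      exact Real.sqrt_ne_zero'.2 (lt_of_le_of_ne (norm_nonneg _) (Ne.symm h0))
    field_simp

omit [CompleteSpace E] in
/-- The rescaled data satisfy the nuclear summability hypothesis: `Σ_k ‖1‖ (‖p_k‖² + ‖q_k‖²) = 2 Σ_k ‖T e_k‖ < ∞`. [cite: ReedSimon1972, Thm. VI.24 (proof)] -/
theorem summable_rescale_of_summable_norm_apply (hT : Summable fun k => ‖T (e k)‖) :
    Summable fun k => ‖(1 : ℂ)‖ *
      (‖((Real.sqrt ‖T (e k)‖ : ℂ)⁻¹) • T (e k)‖ ^ 2 + ‖(Real.sqrt ‖T (e k)‖ : ℂ) • (e k)‖ ^ 2) := by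
  refine (hT.mul_left 2).congr fun k => ?_
  rw [norm_sqrt_inv_smul_apply, norm_sqrt_smul_basis, Real.sq_sqrt (norm_nonneg _), norm_one, one_mul]
  ring

omit [CompleteSpace E] in
/-- The value of that sum: `Σ_k ‖1‖ (‖p_k‖² + ‖q_k‖²) = 2 Σ_k ‖T e_k‖`. [cite: ReedSimon1972, Thm. VI.24 (proof)] -/
theorem tsum_rescale_eq :
    ∑' k, ‖(1 : ℂ)‖ *
      (‖((Real.sqrt ‖T (e k)‖ : ℂ)⁻¹) • T (e k)‖ ^ 2 + ‖(Real.sqrt ‖T (e k)‖ : ℂ) • (e k)‖ ^ 2) =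
      2 * ∑' k, ‖T (e k)‖ := by
  rw [← tsum_mul_left]
  refine tsum_congr fun k => ?_
  rw [norm_sqrt_inv_smul_apply, norm_sqrt_smul_basis, Real.sq_sqrt (norm_nonneg _), norm_one, one_mul]
  ring

end Rescale

/-! ## (ii) The diagonal along every Hilbert basis is absolutely summable -/

omit [CompleteSpace E] in
/-- **Nuclear along `e` ⇒ absolutely summable diagonal along every Hilbert basis `b`**, with
`Σ_j |⟨b_j, T b_j⟩| ≤ 2 Σ_k ‖T e_k‖`, and the double family `(j,k) ↦ ⟨e_k, b_j⟩⟨b_j, T e_k⟩` absolutely summable.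
[cite: ReedSimon1972, Thm. VI.18 and VI.24, PDF pp. 196–199] -/
theorem summable_norm_inner_apply_self_of_summable_norm_apply (e : HilbertBasis ι ℂ E) (T : E →L[ℂ] E)
    (hT : Summable fun k => ‖T (e k)‖) (b : HilbertBasis ι' ℂ E) :
    (Summable fun jk : ι' × ι => ⟪e jk.2, b jk.1⟫_ℂ * ⟪b jk.1, T (e jk.2)⟫_ℂ) ∧
    (Summable fun j => ‖⟪b j, T (b j)⟫_ℂ‖) ∧
    ∑' j, ‖⟪b j, T (b j)⟫_ℂ‖ ≤ 2 * ∑' k, ‖T (e k)‖ := by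
  obtain ⟨hA, hS, hB⟩ := tsum_norm_rankOne_diag_le b.orthonormal
    (fun k => ((Real.sqrt ‖T (e k)‖ : ℂ)⁻¹) • T (e k)) (fun k => (Real.sqrt ‖T (e k)‖ : ℂ) • (e k)) (fun _ => (1 : ℂ))
    (summable_rescale_of_summable_norm_apply e T hT)
  simp only [one_mul, inner_rescale_mul_inner_rescale] at hA hS hB
  have hdiag : ∀ j, ∑' k, ⟪e k, b j⟫_ℂ * ⟪b j, T (e k)⟫_ℂ = ⟪b j, T (b j)⟫_ℂ := fun j =>
    (hasSum_inner_mul_inner_apply_diag e T (b j)).tsum_eq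
  simp only [hdiag] at hS hB
  refine ⟨hA, hS, hB.trans (le_of_eq ?_)⟩
  exact tsum_rescale_eq e T

omit [CompleteSpace E] in
/-- **(ii) alone**: the diagonal `j ↦ ⟨b_j, T b_j⟩` is summable along every Hilbert basis. [cite: ReedSimon1972, Thm. VI.24] -/
theorem summable_inner_apply_self_of_summable_norm_apply (e : HilbertBasis ι ℂ E) (T : E →L[ℂ] E)
    (hT : Summable fun k => ‖T (e k)‖) (b : HilbertBasis ι' ℂ E) :
    Summable fun j => ⟪b j, T (b j)⟫_ℂ :=
  (summable_norm_inner_apply_self_of_summable_norm_apply e T hT b).2.1.of_norm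

omit [CompleteSpace E] in
/-- **The trace-norm style bound** `Σ_j |⟨b_j, T b_j⟩| ≤ 2 Σ_k ‖T e_k‖`. [cite: ReedSimon1972, Thm. VI.24] -/
theorem tsum_norm_inner_apply_self_le (e : HilbertBasis ι ℂ E) (T : E →L[ℂ] E)
    (hT : Summable fun k => ‖T (e k)‖) (b : HilbertBasis ι' ℂ E) :
    ∑' j, ‖⟪b j, T (b j)⟫_ℂ‖ ≤ 2 * ∑' k, ‖T (e k)‖ :=
  (summable_norm_inner_apply_self_of_summable_norm_apply e T hT b).2.2

/-! ## (iii) The diagonal sum is basis free -/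

omit [CompleteSpace E] in
/-- **`Σ_j ⟨b_j, T b_j⟩ = Σ_k ⟨e_k, T e_k⟩`** for every Hilbert basis `b` when `Σ_k ‖T e_k‖ < ∞`: interchange the absolutely
summable double series `Σ_j Σ_k ⟨e_k, b_j⟩⟨b_j, T e_k⟩` and resum with Parseval `Σ_j ⟨e_k, b_j⟩⟨b_j, T e_k⟩ = ⟨e_k, T e_k⟩`.
[cite: ReedSimon1972, Thm. VI.24, PDF p. 199] -/
theorem tsum_inner_apply_self_eq_of_summable_norm_apply (e : HilbertBasis ι ℂ E) (T : E →L[ℂ] E)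
    (hT : Summable fun k => ‖T (e k)‖) (b : HilbertBasis ι' ℂ E) :
    ∑' j, ⟪b j, T (b j)⟫_ℂ = ∑' k, ⟪e k, T (e k)⟫_ℂ := by
  obtain ⟨hA, -, -⟩ := summable_norm_inner_apply_self_of_summable_norm_apply e T hT b
  have hA' : Summable fun kj : ι × ι' => ⟪e kj.1, b kj.2⟫_ℂ * ⟪b kj.2, T (e kj.1)⟫_ℂ :=
    (Equiv.prodComm ι ι').summable_iff.2 hA |>.congr fun _ => rfl
  calc ∑' j, ⟪b j, T (b j)⟫_ℂ
      = ∑' j, ∑' k, ⟪e k, b j⟫_ℂ * ⟪b j, T (e k)⟫_ℂ :=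
        tsum_congr fun j => ((hasSum_inner_mul_inner_apply_diag e T (b j)).tsum_eq).symm
    _ = ∑' jk : ι' × ι, ⟪e jk.2, b jk.1⟫_ℂ * ⟪b jk.1, T (e jk.2)⟫_ℂ := (hA.tsum_prod).symm
    _ = ∑' kj : ι × ι', ⟪e kj.1, b kj.2⟫_ℂ * ⟪b kj.2, T (e kj.1)⟫_ℂ :=
        ((Equiv.prodComm ι ι').tsum_eq (fun jk : ι' × ι => ⟪e jk.2, b jk.1⟫_ℂ * ⟪b jk.1, T (e jk.2)⟫_ℂ)).symm
    _ = ∑' k, ∑' j, ⟪e k, b j⟫_ℂ * ⟪b j, T (e k)⟫_ℂ := hA'.tsum_prod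
    _ = ∑' k, ⟪e k, T (e k)⟫_ℂ := tsum_congr fun k => (b.hasSum_inner_mul_inner (e k) (T (e k))).tsum_eq

omit [CompleteSpace E] in
/-- **(iii) The diagonal sum does not depend on the Hilbert basis** (both equal `Σ_k ⟨e_k, T e_k⟩`). [cite: ReedSimon1972, Thm. VI.24] -/
theorem tsum_inner_apply_self_eq_of_hilbertBasis_of_summable_norm_apply {ι'' : Type*} (e : HilbertBasis ι ℂ E)
    (T : E →L[ℂ] E) (hT : Summable fun k => ‖T (e k)‖) (b : HilbertBasis ι' ℂ E) (b' : HilbertBasis ι'' ℂ E) :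
    ∑' j, ⟪b j, T (b j)⟫_ℂ = ∑' j, ⟪b' j, T (b' j)⟫_ℂ := by
  rw [tsum_inner_apply_self_eq_of_summable_norm_apply e T hT b, tsum_inner_apply_self_eq_of_summable_norm_apply e T hT b']

/-! ## (i) Hilbert–Schmidt along every Hilbert basis -/

omit [CompleteSpace E] in
/-- `Σ_k ‖T e_k‖² ≤ (Σ_k ‖T e_k‖)²`-type comparison: `Σ_k ‖T e_k‖ < ∞ ⇒ Σ_k ‖T e_k‖² < ∞` (a nuclear operator is Hilbert–Schmidt along
its own basis). [cite: ReedSimon1972, Thm. VI.22 (b), VI.24] -/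
theorem summable_norm_sq_apply_self_of_summable_norm_apply (e : HilbertBasis ι ℂ E) (T : E →L[ℂ] E)
    (hT : Summable fun k => ‖T (e k)‖) : Summable fun k => ‖T (e k)‖ ^ 2 := by
  refine Summable.of_nonneg_of_le (fun k => sq_nonneg _) (fun k => ?_) (hT.mul_right (∑' k, ‖T (e k)‖))
  rw [sq]
  exact mul_le_mul_of_nonneg_left (hT.le_tsum k fun j _ => norm_nonneg _) (norm_nonneg _)

/-- **(i) Nuclear along `e` ⇒ Hilbert–Schmidt along every Hilbert basis**: `Σ_j ‖T b_j‖² < ∞` (real summability); by the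
basis-independence of the Hilbert–Schmidt sum ★ `tsum_enorm_sq_apply_eq_of_hilbertBasis`. [cite: ReedSimon1972, Thm. VI.22 (b), VI.24] -/
theorem summable_norm_sq_apply_of_summable_norm_apply (e : HilbertBasis ι ℂ E) (T : E →L[ℂ] E)
    (hT : Summable fun k => ‖T (e k)‖) (b : HilbertBasis ι' ℂ E) : Summable fun j => ‖T (b j)‖ ^ 2 := by
  have he : Summable fun k => ‖T (e k)‖ ^ 2 := summable_norm_sq_apply_self_of_summable_norm_apply e T hT
  -- pass through `ℝ≥0∞`, where the Hilbert–Schmidt sum is basis free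
  have he' : Summable fun k => ‖T (e k)‖₊ ^ 2 := by
    rw [← NNReal.summable_coe]; simpa only [NNReal.coe_pow, coe_nnnorm] using he
  have htop : (∑' k, ((‖T (e k)‖₊ ^ 2 : ℝ≥0) : ℝ≥0∞)) ≠ ∞ := ENNReal.tsum_coe_ne_top_iff_summable.2 he'
  have heq : ∑' j, ((‖T (b j)‖₊ ^ 2 : ℝ≥0) : ℝ≥0∞) = ∑' k, ((‖T (e k)‖₊ ^ 2 : ℝ≥0) : ℝ≥0∞) := by
    have h := tsum_enorm_sq_apply_eq_of_hilbertBasis b e T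
    simpa only [enorm_eq_nnnorm, ENNReal.coe_pow] using h
  have hb' : Summable fun j => ‖T (b j)‖₊ ^ 2 := by
    rw [← ENNReal.tsum_coe_ne_top_iff_summable, heq]; exact htop
  have := NNReal.summable_coe.2 hb'
  simpa only [NNReal.coe_pow, coe_nnnorm] using this

/-- **(i) in `ℝ≥0∞`**: `Σ_j ‖T b_j‖² < ∞` for every Hilbert basis `b`. [cite: ReedSimon1972, Thm. VI.22 (b), VI.24] -/
theorem tsum_coe_nnnorm_sq_apply_lt_top_of_summable_norm_apply (e : HilbertBasis ι ℂ E) (T : E →L[ℂ] E)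
    (hT : Summable fun k => ‖T (e k)‖) (b : HilbertBasis ι' ℂ E) :
    ∑' j, (‖T (b j)‖₊ : ℝ≥0∞) ^ 2 < ∞ := by
  have hb : Summable fun j => ‖T (b j)‖₊ ^ 2 := by
    rw [← NNReal.summable_coe]
    simpa only [NNReal.coe_pow, coe_nnnorm] using summable_norm_sq_apply_of_summable_norm_apply e T hT b
  have h := ENNReal.tsum_coe_ne_top_iff_summable.2 hb
  simp only [ENNReal.coe_pow] at h
  exact lt_top_iff_ne_top.2 h

/-! ## The three clauses packaged -/

/-- **NUCLEAR ALONG ONE HILBERT BASIS ⇒ THE THREE TRACE-CLASS CLAUSES** (the shape consumed by the automorphic letter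
★ `ArchIntegratedOperatorTraceClass`, [Knapp1986, Thm. 10.2]): if `Σ_k ‖T e_k‖ < ∞` for some Hilbert basis `e`, then for every Hilbert
basis `b`: `Σ_j ‖T b_j‖² < ∞`, the diagonal `j ↦ ⟨b_j, T b_j⟩` is summable, and its sum equals that along any other Hilbert basis `b'`.
[cite: ReedSimon1972, Thm. VI.18, VI.22, VI.24, PDF pp. 196–199] [cite: Knapp1986, Thm. 10.2] -/
theorem traceClass_clauses_of_summable_norm_apply (e : HilbertBasis ι ℂ E) (T : E →L[ℂ] E)
    (hT : Summable fun k => ‖T (e k)‖) :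
    ∀ (κ : Type*) (b : HilbertBasis κ ℂ E),
      (∑' j, (‖T (b j)‖₊ : ℝ≥0∞) ^ 2 < ∞) ∧
      Summable (fun j => ⟪b j, T (b j)⟫_ℂ) ∧
      ∀ (κ' : Type*) (b' : HilbertBasis κ' ℂ E), ∑' j, ⟪b j, T (b j)⟫_ℂ = ∑' j, ⟪b' j, T (b' j)⟫_ℂ :=
  fun _ b => ⟨tsum_coe_nnnorm_sq_apply_lt_top_of_summable_norm_apply e T hT b,
    summable_inner_apply_self_of_summable_norm_apply e T hT b,
    fun _ b' => tsum_inner_apply_self_eq_of_hilbertBasis_of_summable_norm_apply e T hT b b'⟩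

omit [CompleteSpace E] in
/-- **The common value is the `e`-diagonal** `Σ_k ⟨e_k, T e_k⟩`, itself absolutely summable with `Σ_k |⟨e_k, T e_k⟩| ≤ Σ_k ‖T e_k‖`.
[cite: ReedSimon1972, Thm. VI.24] -/
theorem summable_norm_inner_basis_apply_of_summable_norm_apply (e : HilbertBasis ι ℂ E) (T : E →L[ℂ] E)
    (hT : Summable fun k => ‖T (e k)‖) :
    (Summable fun k => ‖⟪e k, T (e k)⟫_ℂ‖) ∧ ∑' k, ‖⟪e k, T (e k)⟫_ℂ‖ ≤ ∑' k, ‖T (e k)‖ := by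
  have hle : ∀ k, ‖⟪e k, T (e k)⟫_ℂ‖ ≤ ‖T (e k)‖ := fun k => by
    calc ‖⟪e k, T (e k)⟫_ℂ‖ ≤ ‖e k‖ * ‖T (e k)‖ := norm_inner_le_norm _ _
      _ = ‖T (e k)‖ := by rw [e.orthonormal.1 k, one_mul]
  have hs : Summable fun k => ‖⟪e k, T (e k)⟫_ℂ‖ := Summable.of_nonneg_of_le (fun _ => norm_nonneg _) hle hT
  exact ⟨hs, hs.tsum_le_tsum hle hT⟩

end Literature.Analysis.OperatorTheory

end
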